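import Summits.HodgeConjecture.HodgeConjecture.Theorems.PadicSemiregularLiftHodgeFermatVarietiesPQStructure
import HarnessLib

/-!
# Hodge `(p+1)`-tuples of level `pq`, II: the unit part is symmetric off one fibre — line `cancel-by-any-claim-lattice`, crux `HodgeFermatVarieties` (stmt-HodgeConjecture-1334)

Second file of lead c3's LEVEL-`pq` programme (primes `5 ≤ p`, `p + 2 < q`). THEOREM (`structure_units`):
for a Hodge multiset `s` of `p + 1` elements of `ℤ/pq`, either `c(x) = c(-x)` for every unit `x` (the unit
part is symmetric), or there is a residue `b₁ ∈ (ℤ/q)ˣ` such that `c(x) ≥ c(-x) + 1` on the whole fibre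
`{x unit : x ≡ b₁ (q)}` and `c(x) = c(-x)` for the units off the fibres of `±b₁`. Proof: COUNTING the support
of `o = c - c∘neg = G + H` (`PQ.units_oddPart_split`): it has at most `2(p+1)` points; if `H ≢ 0` it has at
least `2(q-1)` (two per fibre, `PQ.two_le_card_units`), so `q ≤ p + 2` — excluded (this is where `q ≠ p + 2`
enters; the twin case `(5, 7)` is `FiveQ.structure_units`); if `H ≡ 0 ≢ G` the support is the union of the
fibres (`p - 1` points each) over the support of `G`, an even set of size `≤ 2(p+1)/(p-1) < 4`, i.e. `{b₀, -b₀}`.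

References: [Aoki1983] N. Aoki, Math. Ann. 266 (1983) §2 Prop. 2.2, Thm A′ (§7).
-/

set_option linter.dupNamespace false

noncomputable section

open Finset
open Literature.AlgebraicGeometry.HodgeTheory Literature.AlgebraicGeometry.HodgeTheory.FermatCharacter

open Summit.HodgeConjecture.HodgeConjecture.Theorems.CancelByAnyClaimLattice.FiveQ

namespace Summit.HodgeConjecture.HodgeConjecture.Theorems.CancelByAnyClaimLattice.PQ

section LevelPQ

variable {p q : ℕ} [Fact p.Prime] [Fact q.Prime]

/-! ### The structure of the unit entries -/

/-- **STRUCTURE OF THE UNIT ENTRIES OF A HODGE `(p+1)`-TUPLE OF LEVEL `pq`** (primes `5 ≤ p`, `p + 2 < q`):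
either the unit part is symmetric, `c(x) = c(-x)` for every unit `x`; or for some `b₁ ∈ (ℤ/q)ˣ` the whole
fibre `{x ≡ b₁ (q)}` of units is occupied, `c(x) ≥ c(-x) + 1` there, and `c(x) = c(-x)` for the units off
the fibres of `±b₁`. Proof by counting the support of `o = c - c∘neg = G + H` (module docstring).
[cite: Aoki1983, Thm. A′ (§7)] -/
theorem structure_units_pq : ∀ {p q : ℕ} [Fact p.Prime] [Fact q.Prime], 5 ≤ p → p + 2 < q → ∀ {s : Multiset (ZMod (p * q))}, IsHodgeMultiset s →
    Multiset.card s = p + 1 →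
    (∀ x : (ZMod (p * q))ˣ, Multiset.count (x : ZMod (p * q)) s = Multiset.count (-(x : ZMod (p * q))) s) ∨
    ∃ b₁ : (ZMod q)ˣ,
      (∀ x : (ZMod (p * q))ˣ, ZMod.unitsMap (dvd_mul_left q p) x = b₁ →
        Multiset.count (-(x : ZMod (p * q))) s + 1 ≤ Multiset.count (x : ZMod (p * q)) s) ∧
      (∀ x : (ZMod (p * q))ˣ, ZMod.unitsMap (dvd_mul_left q p) x ≠ b₁ → ZMod.unitsMap (dvd_mul_left q p) x ≠ -b₁ →
        Multiset.count (x : ZMod (p * q)) s = Multiset.count (-(x : ZMod (p * q))) s) := by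
  intro p q _ _ hp hpq' s hs h6
  classical
  have hpq : p ≠ q := by omega
  obtain ⟨G, H, hG, hH, ho⟩ := units_oddPart_split_pq hpq hs
  have hA : Multiset.card (s.filter IsUnit) ≤ p + 1 := (Multiset.card_le_card (Multiset.filter_le _ _)).trans h6.le
  have hsupp_le := card_support_le ho
  -- Case 1: `H ≢ 0` is impossible: `2(q-1) ≤ #supp(o) ≤ 2(p+1)` contradicts `p + 2 < q`
  by_cases hH0 : ∃ a, H a ≠ 0
  · exfalso
    have hge := card_support_ge hp hpq (G := G) hH hH0
    omega
  -- Case 2: `H ≡ 0`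
  push Not at hH0
  have ho' : ∀ x : (ZMod (p * q))ˣ, (Multiset.count (x : ZMod (p * q)) s : ℂ) - Multiset.count (-(x : ZMod (p * q))) s =
      G (ZMod.unitsMap (dvd_mul_left q p) x) := fun x ↦ by rw [ho x, hH0, add_zero]
  by_cases hG0 : ∀ b, G b = 0
  · -- symmetric unit part
    left
    intro x
    have h := ho' x
    rw [hG0, sub_eq_zero] at h
    exact_mod_cast h
  · right
    push Not at hG0
    -- the support of `G` is `{b₀, -b₀}`: it is negation-stable without fixed points and has ≤ 3 elements
    set SG : Finset (ZMod q)ˣ := univ.filter fun b ↦ G b ≠ 0 with hSG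
    have hSGneg : ∀ b, b ∈ SG ↔ -b ∈ SG := fun b ↦ by
      simp only [hSG, mem_filter, mem_univ, true_and, hG b, neg_ne_zero]
    have hfix : ∀ b : (ZMod q)ˣ, b ≠ -b := units_ne_neg (by omega)
    -- the support of `o` is the union of the fibres over `SG`
    have hsupp_eq : #(univ.filter fun x : (ZMod (p * q))ˣ ↦
        G (ZMod.unitsMap (dvd_mul_left q p) x) + H (ZMod.unitsMap (dvd_mul_right p q) x) ≠ 0) = (p - 1) * #SG := by
      rw [card_eq_sum_card_fibre]
      have hfib : ∀ b : (ZMod q)ˣ, #((univ.filter fun x : (ZMod (p * q))ˣ ↦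
          G (ZMod.unitsMap (dvd_mul_left q p) x) + H (ZMod.unitsMap (dvd_mul_right p q) x) ≠ 0).filter
            fun x ↦ ZMod.unitsMap (dvd_mul_left q p) x = b) = if G b ≠ 0 then p - 1 else 0 := by
        intro b
        by_cases hb : G b ≠ 0
        · rw [if_pos hb]
          have : ((univ.filter fun x : (ZMod (p * q))ˣ ↦
              G (ZMod.unitsMap (dvd_mul_left q p) x) + H (ZMod.unitsMap (dvd_mul_right p q) x) ≠ 0).filter
                fun x ↦ ZMod.unitsMap (dvd_mul_left q p) x = b) =
              univ.filter fun x : (ZMod (p * q))ˣ ↦ ZMod.unitsMap (dvd_mul_left q p) x = b := by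
            ext x
            simp only [mem_filter, mem_univ, true_and, and_iff_right_iff_imp]
            intro hx
            rw [hx, hH0, add_zero]; exact hb
          rw [this, card_fibre hpq b]
        · rw [if_neg hb]
          rw [Finset.card_eq_zero, Finset.filter_eq_empty_iff]
          intro x hx hxb
          simp only [mem_filter, mem_univ, true_and] at hx
          rw [hxb, hH0, add_zero] at hx
          exact hb hx
      rw [Finset.sum_congr rfl fun b _ ↦ hfib b, Finset.sum_ite, Finset.sum_const_zero, add_zero,
        Finset.sum_const, smul_eq_mul, mul_comm]
    have hSG3 : #SG ≤ 3 := by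
      have h := hsupp_le
      rw [hsupp_eq] at h
      -- `(p - 1) #SG ≤ 2 (p + 1)` with `p ≥ 5` forces `#SG ≤ 3`
      by_contra h4
      push Not at h4
      have : (p - 1) * 4 ≤ (p - 1) * #SG := Nat.mul_le_mul_left _ h4
      omega
    -- an element `b₀` of the support and the involution without fixed points: `#SG` is even
    obtain ⟨b₀, hb₀⟩ := hG0
    have hb₀S : b₀ ∈ SG := by simp [hSG, hb₀]
    have hSG2 : SG = {b₀, -b₀} := by
      -- `{b₀, -b₀} ⊆ SG`, and a third element would bring its negative too
      have hsub : ({b₀, -b₀} : Finset (ZMod q)ˣ) ⊆ SG := by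
        intro b hb
        simp only [mem_insert, mem_singleton] at hb
        rcases hb with rfl | rfl
        · exact hb₀S
        · exact (hSGneg b₀).mp hb₀S
      by_contra hne
      have hss : ({b₀, -b₀} : Finset (ZMod q)ˣ) ⊂ SG := lt_of_le_of_ne hsub (Ne.symm hne)
      obtain ⟨b, hbS, hbnot⟩ := Finset.exists_of_ssubset hss
      have hbnot' : -b ∉ ({b₀, -b₀} : Finset (ZMod q)ˣ) := by
        simp only [mem_insert, mem_singleton, not_or] at hbnot ⊢
        exact ⟨fun h ↦ hbnot.2 (by rw [← h, neg_neg]), fun h ↦ hbnot.1 (neg_injective h)⟩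
      have h4 : ({b₀, -b₀, b, -b} : Finset (ZMod q)ˣ) ⊆ SG := by
        intro x hx
        simp only [mem_insert, mem_singleton] at hx
        rcases hx with rfl | rfl | rfl | rfl
        · exact hb₀S
        · exact (hSGneg b₀).mp hb₀S
        · exact hbS
        · exact (hSGneg b).mp hbS
      have hcard4 : #({b₀, -b₀, b, -b} : Finset (ZMod q)ˣ) = 4 := by
        simp only [mem_insert, mem_singleton, not_or] at hbnot hbnot'
        rw [card_insert_of_notMem, card_insert_of_notMem, card_pair (hfix b)]
        · simp only [mem_insert, mem_singleton, not_or]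
          exact ⟨fun h ↦ hbnot.2 h.symm, fun h ↦ hbnot'.2 h.symm⟩
        · simp only [mem_insert, mem_singleton, not_or]
          exact ⟨hfix b₀, fun h ↦ hbnot.1 h.symm, fun h ↦ hbnot'.1 h.symm⟩
      have := card_le_card h4
      omega
    -- the value of `o` on the fibre of `b₀` is a non-zero integer; orient it
    have hval : ∀ x : (ZMod (p * q))ˣ, ZMod.unitsMap (dvd_mul_left q p) x = b₀ →
        (Multiset.count (x : ZMod (p * q)) s : ℂ) - Multiset.count (-(x : ZMod (p * q))) s = G b₀ :=
      fun x hx ↦ by rw [ho' x, hx]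
    have hoff : ∀ x : (ZMod (p * q))ˣ, ZMod.unitsMap (dvd_mul_left q p) x ≠ b₀ →
        ZMod.unitsMap (dvd_mul_left q p) x ≠ -b₀ →
        Multiset.count (x : ZMod (p * q)) s = Multiset.count (-(x : ZMod (p * q))) s := by
      intro x h1 h2
      have hx : ZMod.unitsMap (dvd_mul_left q p) x ∉ SG := by
        rw [hSG2]; simp [h1, h2]
      simp only [hSG, mem_filter, mem_univ, true_and, not_not] at hx
      have h := ho' x
      rw [hx, sub_eq_zero] at h
      exact_mod_cast h
    -- pick `x₀` in the fibre of `b₀` and read the sign of `c(x₀) - c(-x₀)`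
    obtain ⟨x₀, -, hx₀⟩ := exists_unit_of_unitsMap hpq (1 : (ZMod p)ˣ) b₀
    rcases lt_or_ge (Multiset.count (-(x₀ : ZMod (p * q))) s) (Multiset.count (x₀ : ZMod (p * q)) s) with hlt | hge
    · -- `G b₀ > 0`: the fibre of `b₀` is the occupied one
      refine ⟨b₀, fun x hx ↦ ?_, hoff⟩
      have h := hval x hx
      rw [← hval x₀ hx₀] at h
      have h' : (Multiset.count (x : ZMod (p * q)) s : ℤ) - Multiset.count (-(x : ZMod (p * q))) s =
          (Multiset.count (x₀ : ZMod (p * q)) s : ℤ) - Multiset.count (-(x₀ : ZMod (p * q))) s := by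
        exact_mod_cast h
      omega
    · -- `G b₀ < 0` (it is non-zero): the fibre of `-b₀` is the occupied one
      have hne : Multiset.count (-(x₀ : ZMod (p * q))) s ≠ Multiset.count (x₀ : ZMod (p * q)) s := by
        intro heq
        apply hb₀
        rw [← hval x₀ hx₀, heq, sub_self]
      refine ⟨-b₀, fun x hx ↦ ?_, fun x h1 h2 ↦ hoff x (by rw [neg_neg] at h2; exact h2) h1⟩
      -- `-x` lies in the fibre of `b₀`
      have hx' : ZMod.unitsMap (dvd_mul_left q p) (-x) = b₀ := by rw [unitsMap_neg, hx, neg_neg]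
      have h := hval (-x) hx'
      rw [← hval x₀ hx₀, Units.val_neg, neg_neg] at h
      have h' : (Multiset.count (-(x : ZMod (p * q))) s : ℤ) - Multiset.count (x : ZMod (p * q)) s =
          (Multiset.count (x₀ : ZMod (p * q)) s : ℤ) - Multiset.count (-(x₀ : ZMod (p * q))) s := by
        exact_mod_cast h
      omega

end LevelPQ

end Summit.HodgeConjecture.HodgeConjecture.Theorems.CancelByAnyClaimLattice.PQ
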